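import Summits.ResolutionOfSingularities.ResolutionOfSingularities.Theorems.MarkedTransferCampaignW36SymbolicFG
import HarnessLib

/-!
# [L1 W3.6 · SYMBOLIC-FG DOOR, Defs] The class `CampaignW36.SymbolicFGClass`: «the symbolic algebra `⊕_d 𝓘_{Σ̄_max}^{⟨d⟩}(U) X^d` of the
# closure of the `Inv_max`-stratum is a finitely generated `Γ(U)`-algebra on every affine open `U`» — in p487786's class shape `𝒞 Ê Σ_max`

Cell `res-hironaka`, rung L, slot W3.6 lineage (seat res-L1-s36-pv-1, g1); GAP-LEDGER R12/12a residual ⟨StableTower⟩ OFF the class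
`𝒞 = LCIOrMonomialClass`. HOST item stmt-ResolutionOfSingularities-16155 via `--supports`. ONE definition, no theorem content beyond its
unfolding. HONEST FRAMING (D-0012/D-0089): an OURS class predicate over OUR typed carriers (res-type-010's `S06BaseHike.diffPower`, row 003's
rendering device `S04CharAlgebra.familySubalgebra` = the Rees-type algebra `⊕ Q_d X^d ⊆ O[X]` carrying the typed `U16_1`); it replaces the role
of NOTHING printed — the manuscript never reads the geometry of `Σ̄_max` and prints no existence argument for `Ě` (§6.2 p.30 l.4–9); NOT a
statement of the manuscript; nothing of [Hironaka2017] is asserted and the manuscript stays «under review». AI-produced; weaker than expert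
review.

WHY THIS CLASS. By `CampaignW36.veronese_iff_symbolicAlgebra_fg` (p-file `MarkedTransferCampaignW36SymbolicFG`) membership is EQUIVALENT, on
the (Noetherian) ambient scheme, to the Veronese shape `∃ b₀ > 0, ∀ k, 𝓘_C^{⟨k b₀⟩} ≤ (𝓘_C^{⟨b₀⟩})^k` through which the W3.6 door reaches `Ě`
(res-type-010's `stableAt_of_veronese` / `exists_isCoreFocus_of_veroneseCut_ambient`); it CONTAINS `LCIOrMonomialClass` on every ambient
datum (`symbolicAlgebra_fg_lciOrMonomial`, from T-AB p494780) and is the exact reach of the method; and by res-type-010's `U30L4fSymbolicFG`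
(p488059) it is NECESSARY for «`Ě` exists, is standard and has finitely generated `℘`» (the manuscript's own import `U16_1` of [23]). The
door on this class and these links are filed separately (`MarkedTransferCampaignW36SymbolicFGDoor`).
-/

noncomputable section

set_option linter.dupNamespace false -- mandated namespace of this single-conjunct summit

open _root_.AlgebraicGeometry _root_.TopologicalSpace _root_.CategoryTheory

namespace Summit.ResolutionOfSingularities.ResolutionOfSingularities.Theorems

open Literature.AlgebraicGeometry.Resolution
open Literature.AlgebraicGeometry.Hironaka2017
open Literature.AlgebraicGeometry.Hironaka2017.S02Preliminaries
open Literature.AlgebraicGeometry.Hironaka2017.S04CharAlgebra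
open Literature.AlgebraicGeometry.Hironaka2017.S06BaseHike

universe u

namespace CampaignW36

/-- **[OURS · L1 W3.6] `CampaignW36.SymbolicFGClass` — THE SYMBOLIC-FG CLASS** in p487786's shape `𝒞 Ê Σ_max` (the first argument is not
read): the closure `C = Σ̄_max` (`Closeds.closure Σ_max`, as in `LCIClass` / `MonomialClass` / `LCIOrMonomialClass`) has, on EVERY affine open
`U` of the ambient scheme, a finitely generated symbolic (differential-power) algebra `⊕_d 𝓘_C^{⟨d⟩}(U) X^d = familySubalgebra Γ(U)
(d ↦ 𝓘_C^{⟨d⟩}(U)) ⊆ Γ(U)[X]` over `Γ(U)`. Replaces the role of nothing printed; NOT a statement of the manuscript; the widest class on which the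
W3.6 mechanism (Veronese-standard tower ⇒ `StableAt` ⇒ `Ě = focusAt Ê C b₀`) applies, by `veronese_iff_symbolicAlgebra_fg`. [folklore] -/
def SymbolicFGClass ⦃W : Scheme.{u}⦄ (_ : IdealExponent W) (Sig : Set W) : Prop :=
  ∀ U : W.affineOpens,
    (familySubalgebra Γ(W, U) fun d => (diffPower (Closeds.closure Sig) d).ideal U).FG

/-- Unfolding `SymbolicFGClass` (by definition). [folklore] -/
theorem symbolicFGClass_iff ⦃W : Scheme.{u}⦄ (F : IdealExponent W) (Sig : Set W) :
    SymbolicFGClass F Sig ↔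
      ∀ U : W.affineOpens, (familySubalgebra Γ(W, U) fun d => (diffPower (Closeds.closure Sig) d).ideal U).FG :=
  Iff.rfl

/-- The class does not read its first argument (the exponent): membership depends on `Σ_max` alone. [folklore] -/
theorem symbolicFGClass_irrel ⦃W : Scheme.{u}⦄ (F G : IdealExponent W) (Sig : Set W) :
    SymbolicFGClass F Sig ↔ SymbolicFGClass G Sig :=
  Iff.rfl

end CampaignW36

end Summit.ResolutionOfSingularities.ResolutionOfSingularities.Theorems
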